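import Mathlib
import Literature.Analysis.OperatorTheory.ContractiveDetComplexity
import Literature.Analysis.OperatorTheory.ContractiveDeterminantalRepresentations
import Summits.ValiantsHypothesis.ValiantsHypothesis.Theorems.ContractivityPricePriceOfContractivityStubOneLargeClassSchur
import Summits.ValiantsHypothesis.ValiantsHypothesis.Theorems.ContractivityPricePriceOfContractivityStubOneLargeClassBounds
import Summits.ValiantsHypothesis.ValiantsHypothesis.Theorems.ContractivityPricePriceOfContractivityStubOneLargeClassAssembly
import HarnessLib

/-!
# Crux `PriceOfContractivity` (stmt-ValiantsHypothesis-10583), line `birth` — stub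
# `stub_stableLifting_oneLargeClass` (♦, stable determinantal lifting, ONE LARGE COLOUR CLASS)

Route `ValiantsHypothesis/ContractivityPrice`, crux K1
(`Summit.ValiantsHypothesis.ValiantsHypothesis.Theses.ContractivityPrice.PriceOfContractivity`).
The open stub `stub_stableLifting` (♦) of the lead's skeleton asks: a Sylvester pencil
`1 + diag (X ∘ κ) · K₀` of size `R ≤ 2 ^ L` whose determinant has no zero on the closed polydisc
of radius `2` is re-realised, at size `R₁ ≤ 2 ^ ((L+d)^d)`, by a matrix `K₁` all of whose
principal minors `det K₁[w]` (`w : Fin (k+1) ↪ Fin R₁`) have modulus `≤ (2 ^ ((L+d)^d)) ^ (k+1)`.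
This file proves the registered partial case `stub_stableLifting_oneLargeClass`: all rows but at
most two carry one colour `x` (colourings `(n)`, `(n,1)`, `(n,2)`, `(n,1,1)`), UNCONDITIONALLY,
with `d = 3`.

## Proof (no Hilbert space; pieces landed in the three imported `…StubOneLargeClass*.lean` files)

Write `K₀ = [[A, B], [C, D]]` with the `x`-rows first (`piece_a_blockIndex`).  Pointwise Schur
complement: `det (1 + diag(ξ1, Y) K₀) = a(ξ) · det (1 + Y M(ξ))`, `a(ξ) = det (1 + ξA)`,
`M(ξ) = D - ξ C (1 + ξA)⁻¹ B` of size `t ≤ 2`, so the pencil determinant is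
`â + Ê₁ X_{c₁} + Ê₃ X_{c₂} + Ê₂ X_{c₁} X_{c₂}` with univariate `a, E_v ∈ ℂ[ξ]` substituted at
`X_x` (`piece_a_schurExpansion`; the `E_v` are bordered determinants `det [[1 + ξA, ξB_S],
[C_S, D_SS]]`, numerators of the principal minors of `M(ξ)`).  Zero-freeness gives, by Vieta on
univariate restrictions, `|E_v(ξ)| ≤ |a(ξ)|` on `|ξ| ≤ 2`, and the eigenvalue factorisation
`a(ξ) = ∏ (1 + λᵢ ξ)`, `|λᵢ| ≤ 1/2`, gives `|a(ξ)| ≤ 3` on the SMALL disc `|ξ| ≤ 2/(R+1)`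
(`piece_b_coeffBounds`); Cauchy's estimate on that disc (`piece_c_cauchy`) bounds the
coefficients `|a_m|, |E_{v,m}| ≤ 3 ((R+1)/2)^m`.  The realisation (`piece_d_assembly`) is
`K₁ = [[A′, B′], [C′, D′]]` with `A′ = -r Sᵀ` the RESCALED backward-shift (companion) matrix of
`a` in the basis `(rξ)^k / a(ξ)` (`r = (R+1)/2`), which has `det (1 + ξA′) = a(ξ)` EXACTLY and
realises `E_v(ξ)/a(ξ) - E_v(0)` through the shift formula (`piece_d_shift`, this file),
`B′ = e₀ · (1,0,1)`, `C′` the rescaled shifted coefficient rows, and `D′` the 3-node trie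
`[[e₁(0), -1, e₁(0)], [e₂(0), 0, e₂(0)], [e₃(0), 0, e₃(0)]]` coloured `(c₁, c₂, c₂)`, whose
pencil determinant is `1 + e₁ y₁ + e₃ y₂ + e₂ y₁ y₂`.  All entries have modulus `≤ 4(R+1)`, so
`(k+1)`-minors are `≤ (k+1)! (4(R+1))^(k+1) ≤ (2^(2L+6))^(k+1) ≤ (2^((L+3)^3))^(k+1)` at size
`R₁ = R + 5 ≤ 2^((L+3)^3)`: `d = 3`.  Everything is folklore linear algebra / one-variable
function theory; no cited facts.

## Contents

* (d₀) `piece_d_shift` and its lemmas: the backward shift `S : f ↦ (f − f(0))/ξ` on the model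
  space `W = {u(ξ)/a(ξ) : deg u ≤ N}` (`a(ξ) = 1 + a₁ξ + … + a_{N+1}ξ^{N+1}`) in the basis
  `f_k = ξ^k / a(ξ)` is a companion-type matrix (column `0` is `−(a₁, …, a_{N+1})`,
  `S f_k = f_{k−1}`); purely algebraically over `ℂ`: `κ(ξ) ᵥ* (1 − ξ·S) = a(ξ) · e₀`
  (`kappa_vecMul`), `det (1 − ξ·S) = a(ξ)` (`det_one_sub_smul_shiftMat`, PRESCRIBED
  characteristic polynomial), `a(ξ) · ((1 − ξ·S)⁻¹ u)₀ = u(ξ)` (`kernel_identity`),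
  `v(ξ)/a(ξ) − v(0) = ξ · ((1 − ξ·S)⁻¹ ṽ)₀` (`shift_identity`).
* the registered theorem `stub_stableLifting_oneLargeClass`, assembled from the six pieces.
-/

noncomputable section

-- `Summit.<Summit>.<Problem>` repeats `ValiantsHypothesis` by the tree's layout convention (D-0017).
set_option linter.dupNamespace false

namespace Summit.ValiantsHypothesis.ValiantsHypothesis.Theorems.PriceOfContractivity.OneLargeClass

section Shift


open Matrix Finset

variable {N : ℕ}

section ShiftMatrix

/-! Throughout, `S` is the matrix of the backward shift on `{u/a : deg u ≤ N}` in the basis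
`x^k/a`, `k = 0..N` (column `0` is `−(a₁, …, a_{N+1})`, and `S(x^k/a) = x^{k-1}/a` for `k ≥ 1`),
introduced through the hypothesis `hS` on its entries (no auxiliary definition); `a(x)` denotes
`Σ_{j ≤ N+1} a_j x^j`. -/

variable (S : Matrix (Fin (N + 1)) (Fin (N + 1)) ℂ) (a : ℕ → ℂ)
  (hS : ∀ i j : Fin (N + 1), S i j =
    if (j : ℕ) = 0 then -a ((i : ℕ) + 1) else if (i : ℕ) + 1 = (j : ℕ) then (1 : ℂ) else 0)
include hS

/-- The kernel row is a left eigen-relation: `κ(x) ᵥ* (1 − x·S) = a(x) · e₀`, `κ(x)_k = x^k`.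
[folklore] -/
theorem kappa_vecMul (ha0 : a 0 = 1) (x : ℂ) :
    Matrix.vecMul (fun k : Fin (N + 1) => x ^ (k : ℕ)) (1 - x • S) =
      (∑ j ∈ range (N + 2), a j * x ^ j) • Pi.single (0 : Fin (N + 1)) 1 := by
  ext j
  simp only [vecMul, dotProduct, Matrix.sub_apply, Matrix.one_apply, Matrix.smul_apply,
    hS, smul_eq_mul, Pi.smul_apply, Pi.single_apply]
  by_cases hj : (j : ℕ) = 0
  · -- column 0: 1 + Σ_i a_{i+1} x^{i+1} = a(x)
    have hj' : j = 0 := Fin.ext hj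
    subst hj'
    simp only [Fin.val_zero, ↓reduceIte, mul_sub, mul_ite, mul_one, mul_zero]
    rw [Finset.sum_sub_distrib]
    have h1 : ∑ i : Fin (N + 1), (if i = 0 then x ^ (i : ℕ) else 0) = 1 := by
      rw [Finset.sum_ite_eq']; simp
    rw [h1, Finset.sum_range_succ', ha0]
    simp only [pow_zero, mul_one]
    rw [Fin.sum_univ_eq_sum_range (fun i => x ^ i * (x * -a (i + 1))) (N + 1)]
    have h2 : ∀ i ∈ range (N + 1), x ^ i * (x * -a (i + 1)) = -(a (i + 1) * x ^ (i + 1)) := by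
      intro i _; ring
    rw [Finset.sum_congr rfl h2, Finset.sum_neg_distrib]
    ring
  · -- column j ≥ 1: x^j − x · x^{j-1} = 0
    have hj0 : j ≠ 0 := fun h => hj (by simp [h])
    simp only [hj, ↓reduceIte, if_neg hj0, mul_zero, mul_sub, Finset.sum_sub_distrib]
    have h1 : ∑ i : Fin (N + 1), x ^ (i : ℕ) * (if i = j then (1 : ℂ) else 0) = x ^ (j : ℕ) := by
      simp [Finset.sum_ite_eq']
    have h2 : ∑ i : Fin (N + 1), x ^ (i : ℕ) * (x * if (i : ℕ) + 1 = (j : ℕ) then (1 : ℂ) else 0) =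
        x ^ (j : ℕ) := by
      have hjm : (j : ℕ) - 1 < N + 1 := by omega
      rw [Finset.sum_eq_single ⟨(j : ℕ) - 1, hjm⟩]
      · have : (j : ℕ) - 1 + 1 = (j : ℕ) := by omega
        rw [if_pos this, mul_one, ← pow_succ, this]
      · intro i _ hi
        have : (i : ℕ) + 1 ≠ (j : ℕ) := by
          intro h; apply hi; ext; simp; omega
        simp [this]
      · intro h; exact absurd (Finset.mem_univ _) h
    rw [h1, h2, sub_self]

/-- The lower-right `N × N` block of `1 − x·S` is unit upper-triangular. [folklore] -/
theorem det_submatrix_succ_one_sub_smul_shiftMat (x : ℂ) :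
    ((1 - x • S).submatrix Fin.succ Fin.succ).det = 1 := by
  have hT : ((1 - x • S).submatrix Fin.succ Fin.succ).BlockTriangular id := by
    intro i j hij
    have hij' : (j : ℕ) < (i : ℕ) := hij
    have h1 : (Fin.succ i : Fin (N + 1)) ≠ Fin.succ j := by
      intro h; rw [Fin.succ_inj] at h; subst h; exact lt_irrefl _ hij'
    have h2 : ((Fin.succ j : Fin (N + 1)) : ℕ) ≠ 0 := by simp
    have h3 : ((Fin.succ i : Fin (N + 1)) : ℕ) + 1 ≠ ((Fin.succ j : Fin (N + 1)) : ℕ) := by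
      simp only [Fin.val_succ]; omega
    simp only [submatrix_apply, Matrix.sub_apply, Matrix.one_apply, Matrix.smul_apply, hS,
      smul_eq_mul, if_neg h1, if_neg h2, if_neg h3, mul_zero, sub_zero]
  rw [Matrix.det_of_upperTriangular hT]
  refine Finset.prod_eq_one fun i _ => ?_
  simp [submatrix_apply, Matrix.sub_apply, hS]

/-- `det (1 − x·S) = a(x)`: the state matrix has the PRESCRIBED characteristic polynomial.
[folklore] -/
theorem det_one_sub_smul_shiftMat (ha0 : a 0 = 1) (x : ℂ) :
    (1 - x • S).det = ∑ j ∈ range (N + 2), a j * x ^ j := by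
  set M := 1 - x • S with hM
  -- κ ᵥ* M ᵥ* adj M = det M • κ, and = a(x) • (row 0 of adj M)
  have h1 : Matrix.vecMul (Matrix.vecMul (fun k : Fin (N + 1) => x ^ (k : ℕ)) M) (adjugate M) =
      M.det • (fun k : Fin (N + 1) => x ^ (k : ℕ)) := by
    rw [Matrix.vecMul_vecMul, mul_adjugate, Matrix.vecMul_smul, Matrix.vecMul_one]
  rw [kappa_vecMul S a hS ha0 x] at h1
  have h2 := congr_fun h1 0
  simp only [Matrix.vecMul, dotProduct, Pi.smul_apply, smul_eq_mul, Fin.val_zero, pow_zero,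
    mul_one, Pi.single_apply, mul_ite, mul_zero, ite_mul, zero_mul, Finset.sum_ite_eq',
    Finset.mem_univ, if_true] at h2
  -- adj M 0 0 = det of the lower-right block = 1
  have h3 : adjugate M 0 0 = 1 := by
    rw [adjugate_apply, det_succ_row_zero]
    rw [Finset.sum_eq_single 0]
    · simp only [Fin.val_zero, pow_zero, one_mul, updateRow_self, Pi.single_eq_same, one_mul]
      have : (M.updateRow 0 (Pi.single 0 1)).submatrix Fin.succ (Fin.succAbove 0) =
          M.submatrix Fin.succ Fin.succ := by
        ext i j
        simp
      rw [this, hM, det_submatrix_succ_one_sub_smul_shiftMat S a hS]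
    · intro j _ hj
      simp [updateRow_self, hj]
    · intro h; exact absurd (Finset.mem_univ _) h
  rw [h3, mul_one] at h2
  exact h2.symm

/-- Reproducing identity: `a(x) · ((1 − x·S)⁻¹ u)₀ = Σ_k u_k x^k` whenever `a(x) ≠ 0`. [folklore] -/
theorem kernel_identity (ha0 : a 0 = 1) (x : ℂ) (hx : ∑ j ∈ range (N + 2), a j * x ^ j ≠ 0)
    (u : Fin (N + 1) → ℂ) :
    (∑ j ∈ range (N + 2), a j * x ^ j) * ((1 - x • S)⁻¹ *ᵥ u) 0 =
      ∑ k : Fin (N + 1), u k * x ^ (k : ℕ) := by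
  set M := 1 - x • S with hM
  have hdet : IsUnit M.det := by
    rw [hM, det_one_sub_smul_shiftMat S a hS ha0 x]; exact isUnit_iff_ne_zero.mpr hx
  have h1 : (∑ j ∈ range (N + 2), a j * x ^ j) * (M⁻¹ *ᵥ u) 0 =
      ((∑ j ∈ range (N + 2), a j * x ^ j) • Pi.single (0 : Fin (N+1)) (1 : ℂ)) ⬝ᵥ (M⁻¹ *ᵥ u) := by
    rw [smul_dotProduct, single_one_dotProduct, smul_eq_mul]
  rw [h1, ← kappa_vecMul S a hS ha0 x, ← hM, ← dotProduct_mulVec, Matrix.mulVec_mulVec,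
    Matrix.mul_nonsing_inv _ hdet, Matrix.one_mulVec]
  simp only [dotProduct]
  exact Finset.sum_congr rfl fun k _ => mul_comm _ _

/-- Realisation formula: for `g = v/a` with `deg v ≤ N+1` and `a(x) ≠ 0`,
`g(x) − g(0) = x · ((1 − x·S)⁻¹ (S g))₀`, where `S g` has coefficients
`ṽ_k = v_{k+1} − v₀ a_{k+1}`. [folklore] -/
theorem shift_identity (ha0 : a 0 = 1) (x : ℂ) (hx : ∑ j ∈ range (N + 2), a j * x ^ j ≠ 0)
    (v : ℕ → ℂ) :
    (∑ k ∈ range (N + 2), v k * x ^ k) / (∑ j ∈ range (N + 2), a j * x ^ j) - v 0 =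
      x * ((1 - x • S)⁻¹ *ᵥ (fun k : Fin (N + 1) => v ((k : ℕ) + 1) - v 0 * a ((k : ℕ) + 1))) 0 := by
  have hk := kernel_identity S a hS ha0 x hx (fun k : Fin (N + 1) => v ((k : ℕ) + 1) - v 0 * a ((k : ℕ) + 1))
  -- x · Σ_k ṽ_k x^k = Σ_k v_k x^k − v₀ a(x)
  have hsum : x * ∑ k : Fin (N + 1), (v ((k : ℕ) + 1) - v 0 * a ((k : ℕ) + 1)) * x ^ (k : ℕ) =
      (∑ k ∈ range (N + 2), v k * x ^ k) - v 0 * ∑ j ∈ range (N + 2), a j * x ^ j := by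
    rw [Fin.sum_univ_eq_sum_range (fun k => (v (k + 1) - v 0 * a (k + 1)) * x ^ k) (N + 1)]
    rw [Finset.sum_range_succ' (fun k => v k * x ^ k), Finset.sum_range_succ' (fun j => a j * x ^ j),
      ha0]
    simp only [pow_zero, mul_one]
    rw [Finset.mul_sum]
    have e1 : ∀ k ∈ range (N + 1), x * ((v (k + 1) - v 0 * a (k + 1)) * x ^ k) =
        v (k + 1) * x ^ (k + 1) - v 0 * (a (k + 1) * x ^ (k + 1)) := by
      intro k _; ring
    rw [Finset.sum_congr rfl e1, Finset.sum_sub_distrib, ← Finset.mul_sum]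
    ring
  have key : x * ((1 - x • S)⁻¹ *ᵥ
      (fun k : Fin (N + 1) => v ((k : ℕ) + 1) - v 0 * a ((k : ℕ) + 1))) 0 *
        (∑ j ∈ range (N + 2), a j * x ^ j) =
      (∑ k ∈ range (N + 2), v k * x ^ k) - v 0 * ∑ j ∈ range (N + 2), a j * x ^ j := by
    rw [mul_assoc, mul_comm (((1 - x • S)⁻¹ *ᵥ _) 0) (∑ j ∈ range (N + 2), a j * x ^ j), hk, hsum]
  rw [sub_eq_iff_eq_add, div_eq_iff hx, add_mul, key]
  ring

end ShiftMatrix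

/-- **Piece (d₀): the backward-shift (companion) realisation with prescribed determinant.**
For `a(ξ) = Σ_{j ≤ N+1} a_j ξ^j` with `a₀ = 1`, the matrix `S` of the backward shift
`f ↦ (f - f(0))/ξ` on `{u/a : deg u ≤ N}` in the basis `ξ^k/a` (column `0` is `-(a₁, …, a_{N+1})`,
`S_{k-1,k} = 1`) satisfies `det (1 - ξS) = a(ξ)` and, when `a(ξ) ≠ 0`, the realisation formula
`v(ξ)/a(ξ) - v₀ = ξ · ((1 - ξS)⁻¹ ṽ)₀`, `ṽ_k = v_{k+1} - v₀ a_{k+1}`, for every `v` of degree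
`≤ N+1`. [folklore] -/
theorem piece_d_shift :
    ∀ (N : ℕ) (a : ℕ → ℂ), a 0 = 1 → ∀ ξ : ℂ,
      (1 - ξ • Matrix.of (fun i j : Fin (N + 1) =>
          if (j : ℕ) = 0 then -a ((i : ℕ) + 1) else if (i : ℕ) + 1 = (j : ℕ) then (1 : ℂ) else 0)).det =
        ∑ j ∈ Finset.range (N + 2), a j * ξ ^ j ∧
      (∑ j ∈ Finset.range (N + 2), a j * ξ ^ j ≠ 0 → ∀ v : ℕ → ℂ,
        (∑ k ∈ Finset.range (N + 2), v k * ξ ^ k) / (∑ j ∈ Finset.range (N + 2), a j * ξ ^ j) - v 0 =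
          ξ * ((1 - ξ • Matrix.of (fun i j : Fin (N + 1) =>
              if (j : ℕ) = 0 then -a ((i : ℕ) + 1) else if (i : ℕ) + 1 = (j : ℕ) then (1 : ℂ) else 0))⁻¹ *ᵥ
            (fun k : Fin (N + 1) => v ((k : ℕ) + 1) - v 0 * a ((k : ℕ) + 1))) 0) :=
  fun N a ha0 ξ => ⟨det_one_sub_smul_shiftMat (N := N) _ a (fun _ _ => rfl) ha0 ξ,
    fun hx v => shift_identity (N := N) _ a (fun _ _ => rfl) ha0 ξ hx v⟩


end Shift

section Assembly

open Matrix
open Literature.Analysis.OperatorTheory (eval_det_one_add_diagonal_mul_map_C det_pencil_reindex)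

/-! ### The registered theorem from the pieces -/

/-- Degree of `a = det (1 + ξ • A)` is at most the size of `A`. [folklore] -/
theorem natDegree_det_one_add_X_smul_map {n : ℕ} (A : Matrix (Fin n) (Fin n) ℂ) :
    ((1 : Matrix (Fin n) (Fin n) (Polynomial ℂ)) +
        (Polynomial.X : Polynomial ℂ) • A.map (fun a : ℂ => Polynomial.C a)).det.natDegree ≤ n := by
  have h := Polynomial.natDegree_det_X_add_C_le A (1 : Matrix (Fin n) (Fin n) ℂ)
  rw [Matrix.map_one Polynomial.C (map_zero _) (map_one _), add_comm] at h
  simpa using h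

/-- Size arithmetic: `(R + 5) · 4 (R + 1) ≤ 2 ^ ((L+3)^3)` and `R + 5 ≤ 2 ^ ((L+3)^3)` for
`R ≤ 2 ^ L`. [folklore] -/
theorem size_arith {L R : ℕ} (hR : R ≤ 2 ^ L) :
    R + 1 + 4 ≤ 2 ^ ((L + 3) ^ 3) ∧ (R + 1 + 4) * (4 * (R + 1)) ≤ 2 ^ ((L + 3) ^ 3) := by
  have h1 : 1 ≤ 2 ^ L := Nat.one_le_two_pow
  have hA : R + 1 + 4 ≤ 2 ^ (L + 3) := by
    calc R + 1 + 4 ≤ 2 ^ L + 5 * 2 ^ L := by omega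
      _ ≤ 2 ^ (L + 3) := by rw [pow_add]; omega
  have hB : 4 * (R + 1) ≤ 2 ^ (L + 3) := by
    calc 4 * (R + 1) ≤ 4 * (2 ^ L + 2 ^ L) := by omega
      _ = 2 ^ (L + 3) := by rw [pow_add]; ring
  have hexp : L + 3 ≤ (L + 3) ^ 3 := by
    calc L + 3 = (L + 3) ^ 1 := (pow_one _).symm
      _ ≤ (L + 3) ^ 3 := Nat.pow_le_pow_right (by omega) (by omega)
  have hexp2 : (L + 3) + (L + 3) ≤ (L + 3) ^ 3 := by
    have : (L + 3) + (L + 3) ≤ (L + 3) * (L + 3) ^ 2 := by nlinarith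
    calc (L + 3) + (L + 3) ≤ (L + 3) * (L + 3) ^ 2 := this
      _ = (L + 3) ^ 3 := by ring
  refine ⟨hA.trans (Nat.pow_le_pow_right (by omega) hexp), ?_⟩
  calc (R + 1 + 4) * (4 * (R + 1)) ≤ 2 ^ (L + 3) * 2 ^ (L + 3) := Nat.mul_le_mul hA hB
    _ = 2 ^ ((L + 3) + (L + 3)) := (pow_add _ _ _).symm
    _ ≤ 2 ^ ((L + 3) ^ 3) := Nat.pow_le_pow_right (by omega) hexp2

/-- **Registered partial case ♦ of the stable determinantal lifting (crux `PriceOfContractivity`,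
line `birth`, stub `stub_stableLifting_oneLargeClass`): one large colour class + at most two
further rows, UNCONDITIONAL.**  A Sylvester pencil `det (1 + diag (X ∘ κ) K₀)` of size
`R ≤ 2 ^ L`, zero-free on the closed polydisc of radius `2`, all of whose rows but at most two
carry one colour, is re-realised at size `R₁ = R + 5 ≤ 2 ^ ((L+3)^3)` by a matrix with entries
of modulus `≤ 4(R+1)`, hence `(k+1)`-minors `≤ (k+1)! (4(R+1))^(k+1) ≤ (2^((L+3)^3))^(k+1)`
(`d = 3`); assembled from the landed pieces (a₀), (a), (b), (c), (d) and (d₀) above. [folklore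
assembly of this file's route; paper proof Lines/birth-lifting2.md §2, simplified: no Hilbert
space, rescaled companion realisation instead of the orthonormalised model space] -/
theorem stub_stableLifting_oneLargeClass :
    ∃ d : ℕ, ∀ (L R : ℕ) {σ : Type} (K₀ : Matrix (Fin R) (Fin R) ℂ) (κ : Fin R → σ),
      (∃ a : σ, Nat.card {i : Fin R // κ i ≠ a} ≤ 2) →
      R ≤ 2 ^ L →
      (∀ z : σ → ℂ, (∀ j, ‖z j‖ ≤ 2) → MvPolynomial.eval z (1 + Matrix.diagonal (fun i => MvPolynomial.X (κ i)) * K₀.map (fun a : ℂ => (MvPolynomial.C a : MvPolynomial σ ℂ))).det ≠ 0) →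
      ∃ R₁ ≤ 2 ^ ((L + d) ^ d), ∃ (K₁ : Matrix (Fin R₁) (Fin R₁) ℂ) (κ₁ : Fin R₁ → σ),
        (∀ (k : ℕ) (w : Fin (k + 1) → Fin R₁), Function.Injective w →
          ‖(K₁.submatrix w w).det‖ ≤ ((2 : ℝ) ^ ((L + d) ^ d)) ^ (k + 1)) ∧
        (1 + Matrix.diagonal (fun i => MvPolynomial.X (κ i)) * K₀.map (fun a : ℂ => (MvPolynomial.C a : MvPolynomial σ ℂ))).det =
          (1 + Matrix.diagonal (fun i => MvPolynomial.X (κ₁ i)) * K₁.map (fun a : ℂ => (MvPolynomial.C a : MvPolynomial σ ℂ))).det := by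
  classical
  refine ⟨3, ?_⟩
  intro L R σ K₀ κ hx hR hz
  obtain ⟨x, hx⟩ := hx
  -- (a₀) block indexing: `x`-rows first, `t ≤ 2` foreign rows with colours `c j ≠ x`
  obtain ⟨n, t, e, c, hn, ht, hc, hκ⟩ := piece_a_blockIndex κ x hx
  set K' : Matrix (Fin n ⊕ Fin t) (Fin n ⊕ Fin t) ℂ := Matrix.reindex e e K₀ with hK'
  set P := (1 + Matrix.diagonal (fun i => MvPolynomial.X (κ i)) *
      K₀.map (fun a : ℂ => (MvPolynomial.C a : MvPolynomial σ ℂ))).det with hPdef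
  have hP0 : P = (1 + Matrix.diagonal (fun i => MvPolynomial.X (Sum.elim (fun _ => x) c i)) *
      (Matrix.fromBlocks K'.toBlocks₁₁ K'.toBlocks₁₂ K'.toBlocks₂₁ K'.toBlocks₂₂).map
        (fun a : ℂ => (MvPolynomial.C a : MvPolynomial σ ℂ))).det := by
    rw [Matrix.fromBlocks_toBlocks, hK', hPdef, ← det_pencil_reindex e K₀ κ]
    simp only [hκ]
  -- (a) Schur expansion
  obtain ⟨c₁, c₂, E₁, E₂, E₃, hE₁, hE₂, hE₃, hside, hexp⟩ :=
    piece_a_schurExpansion x c ht hc K'.toBlocks₁₁ K'.toBlocks₁₂ K'.toBlocks₂₁ K'.toBlocks₂₂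
  set A := K'.toBlocks₁₁ with hA
  set a : Polynomial ℂ := ((1 : Matrix (Fin n) (Fin n) (Polynomial ℂ)) +
      (Polynomial.X : Polynomial ℂ) • A.map (fun a : ℂ => Polynomial.C a)).det with ha
  have hPE := hP0.trans hexp
  -- (b) bounds from zero-freeness
  obtain ⟨hb2, hb3⟩ := piece_b_coeffBounds x c₁ c₂ A E₁ E₂ E₃ P hz hPE hside
  have ha0 : a.coeff 0 = 1 := by
    rw [Polynomial.coeff_zero_eq_eval_zero, ha, schur_eval_det_one_add_X_smul]; simp
  have hadeg : a.natDegree ≤ R + 1 + 1 :=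
    (natDegree_det_one_add_X_smul_map A).trans (by omega)
  -- numerology
  set ν : ℝ := (R : ℝ) + 1 with hν
  have hν1 : 1 ≤ ν := by rw [hν]; linarith [R.cast_nonneg (α := ℝ)]
  have hν0 : 0 < ν := by linarith
  set ρ : ℝ := 2 / ν with hρ
  set r : ℝ := ν / 2 with hr
  have hρ0 : 0 < ρ := by positivity
  have hr0 : 0 < r := by positivity
  have hρ2 : ρ ≤ 2 := by
    rw [hρ, div_le_iff₀ hν0]; nlinarith
  have hρn : ρ ≤ 2 / (n + 1) := by
    rw [hρ, hν]
    refine div_le_div_of_nonneg_left (by norm_num) (by positivity) ?_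
    have : (n : ℝ) ≤ R := by exact_mod_cast hn
    linarith
  have hρr : ∀ m : ℕ, (3 : ℝ) / ρ ^ m = 3 * r ^ m := by
    intro m
    rw [hρ, hr, div_pow, div_pow]
    field_simp
  -- sup bounds on the small disc, then Cauchy
  have hsupa : ∀ ξ : ℂ, ‖ξ‖ ≤ ρ → ‖a.eval ξ‖ ≤ 3 := fun ξ hξ => hb3 ξ (hξ.trans hρn)
  have hsupE : ∀ E : Polynomial ℂ, (∀ ξ : ℂ, ‖ξ‖ ≤ 2 → ‖E.eval ξ‖ ≤ ‖a.eval ξ‖) →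
      ∀ ξ : ℂ, ‖ξ‖ ≤ ρ → ‖E.eval ξ‖ ≤ 3 :=
    fun E hE ξ hξ => (hE ξ (hξ.trans hρ2)).trans (hsupa ξ hξ)
  have hcoef : ∀ E : Polynomial ℂ, (∀ ξ : ℂ, ‖ξ‖ ≤ ρ → ‖E.eval ξ‖ ≤ 3) →
      ∀ j : ℕ, ‖E.coeff (j + 1)‖ ≤ 3 * r * r ^ j := by
    intro E hE j
    have h := piece_c_cauchy E ρ 3 hρ0 hE (j + 1)
    rw [hρr, pow_succ] at h
    linarith
  have hE₁b : ∀ ξ : ℂ, ‖ξ‖ ≤ 2 → ‖E₁.eval ξ‖ ≤ ‖a.eval ξ‖ := fun ξ hξ => (hb2 ξ hξ).2.1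
  have hE₂b : ∀ ξ : ℂ, ‖ξ‖ ≤ 2 → ‖E₂.eval ξ‖ ≤ ‖a.eval ξ‖ := fun ξ hξ => (hb2 ξ hξ).2.2.1
  have hE₃b : ∀ ξ : ℂ, ‖ξ‖ ≤ 2 → ‖E₃.eval ξ‖ ≤ ‖a.eval ξ‖ := fun ξ hξ => (hb2 ξ hξ).2.2.2
  have ha1 : ‖a.eval 0‖ = 1 := by
    rw [← Polynomial.coeff_zero_eq_eval_zero, ha0, norm_one]
  have hE0 : ∀ E : Polynomial ℂ, (∀ ξ : ℂ, ‖ξ‖ ≤ 2 → ‖E.eval ξ‖ ≤ ‖a.eval ξ‖) →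
      ‖E.coeff 0‖ ≤ 1 := by
    intro E hE
    rw [Polynomial.coeff_zero_eq_eval_zero, ← ha1]
    exact hE 0 (by simp)
  -- (d) assembly at `N = R + 1`, `M = 3r`
  have hM : (1 : ℝ) ≤ 3 * r := by rw [hr]; linarith
  obtain ⟨K₁, κ₁, hent, hK₁⟩ := piece_d_assembly piece_d_shift x c₁ c₂ (R + 1) r (3 * r)
    a E₁ E₂ E₃ hr0 hM ha0 hadeg (hE₁.trans (by omega)) (hE₂.trans (by omega))
    (hE₃.trans (by omega)) (hcoef a hsupa) (hcoef E₁ (hsupE E₁ hE₁b))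
    (hcoef E₂ (hsupE E₂ hE₂b)) (hcoef E₃ (hsupE E₃ hE₃b)) (hE0 E₁ hE₁b) (hE0 E₂ hE₂b)
    (hE0 E₃ hE₃b)
  obtain ⟨hsize, hprod⟩ := size_arith hR
  refine ⟨R + 1 + 4, hsize, K₁, κ₁, ?_, hPE.trans hK₁.symm⟩
  -- minors from entries
  intro k w hw
  have hent' : ∀ i j, ‖K₁ i j‖ ≤ 4 * ν := fun i j =>
    (hent i j).trans (by rw [hr]; linarith)
  have hk : k + 1 ≤ R + 1 + 4 := by
    simpa [Fintype.card_fin] using Fintype.card_le_of_injective w hw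
  have hdet := Matrix.det_le (A := K₁.submatrix w w) (abv := NormedField.toAbsoluteValue ℂ)
    (x := 4 * ν) (fun i j => by simpa [NormedField.toAbsoluteValue] using hent' (w i) (w j))
  simp only [NormedField.toAbsoluteValue, AbsoluteValue.coe_mk, MulHom.coe_mk, Fintype.card_fin,
    nsmul_eq_mul] at hdet
  have hfact : ((Nat.factorial (k + 1) : ℕ) : ℝ) ≤ ((R + 1 + 4 : ℕ) : ℝ) ^ (k + 1) := by
    exact_mod_cast (Nat.factorial_le_pow _).trans (Nat.pow_le_pow_left hk _)
  have hνN : 4 * ν = ((4 * (R + 1) : ℕ) : ℝ) := by rw [hν]; push_cast; ring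
  calc ‖(K₁.submatrix w w).det‖ ≤ (Nat.factorial (k + 1) : ℝ) * (4 * ν) ^ (k + 1) := hdet
    _ ≤ ((R + 1 + 4 : ℕ) : ℝ) ^ (k + 1) * (4 * ν) ^ (k + 1) :=
        mul_le_mul_of_nonneg_right hfact (by positivity)
    _ = (((R + 1 + 4) * (4 * (R + 1)) : ℕ) : ℝ) ^ (k + 1) := by
        rw [hνN, ← mul_pow, ← Nat.cast_mul]
    _ ≤ ((2 ^ ((L + 3) ^ 3) : ℕ) : ℝ) ^ (k + 1) := by
        gcongr
    _ = ((2 : ℝ) ^ ((L + 3) ^ 3)) ^ (k + 1) := by norm_num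


end Assembly

end Summit.ValiantsHypothesis.ValiantsHypothesis.Theorems.PriceOfContractivity.OneLargeClass
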